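import Summits.CriticalPhenomena.PercolationContinuityZ3.Theorems.Transplant.PlanarSkeletonFrmQuasiDefs
import Summits.CriticalPhenomena.PercolationContinuityZ3.Theorems.Transplant.SkelFrmQuasiBChoiceCreepY3
import Summits.CriticalPhenomena.PercolationContinuityZ3.Theorems.Transplant.SkelFrmBChoiceCreepY3
import Summits.CriticalPhenomena.PercolationContinuityZ3.Theorems.Transplant.SkelFrmQuasi1ChoiceDefs
import Summits.CriticalPhenomena.PercolationContinuityZ3.Theorems.Transplant.SkelFrmQuasi1ParamsLBL
import Summits.CriticalPhenomena.PercolationContinuityZ3.Theorems.Transplant.SkelFrmQuasiBChoiceNums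
import Summits.CriticalPhenomena.PercolationContinuityZ3.Theorems.Transplant.SkelFrmQuasiBChoiceReadNums
import Summits.CriticalPhenomena.PercolationContinuityZ3.Theorems.Transplant.SkelFrmQuasiBChoiceReadings
import Summits.CriticalPhenomena.PercolationContinuityZ3.Theorems.Transplant.SkelFrmQuasiBChoiceWindow3
import Summits.CriticalPhenomena.PercolationContinuityZ3.Theorems.Transplant.SkelFrmQuasiBParamsCorrKG
import Summits.CriticalPhenomena.PercolationContinuityZ3.Theorems.Transplant.SkelFrmQuasiBParamsCorrKG0
import Summits.CriticalPhenomena.PercolationContinuityZ3.Theorems.Transplant.SkelFrmQuasiBParamsCorrKGLen3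
import Summits.CriticalPhenomena.PercolationContinuityZ3.Theorems.Transplant.SkelFrmQuasiBParamsCorrKGY
import Summits.CriticalPhenomena.PercolationContinuityZ3.Theorems.Transplant.SkelFrmQuasiBParamsLF
import Summits.CriticalPhenomena.PercolationContinuityZ3.Theorems.Transplant.SkelFrmQuasiBParamsLFA
import Summits.CriticalPhenomena.PercolationContinuityZ3.Theorems.Transplant.SkelFrmQuasiBParamsSchedA
import HarnessLib
import Summits.CriticalPhenomena.PercolationContinuityZ3.Theorems.Transplant.SkelFrmBChoiceArrivalYW
/-!
# GEN-Q PORT (WAVE-Q table v0.8 section 2, row G138, U-level L17; captain R-6/R-7 2026-08-27: carrier token swap `PlanarSkeletonFrmFrom ↦ PlanarSkeletonFrmQuasi`)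
# of the tree module «Transplant/SkelFrmFromBChoiceArrivalYW» (sha256 1544444ca578e9c2…) onto the quasi-step carrier `PlanarSkeletonFrmQuasi` (p507026): «SkelFrmQuasiBChoiceArrivalYW»

ORIGINAL TITLE: N2 (frames-only node `SamePDropOfSkeletonFrm₁`, OPEN) — (ζ″) at the (R-45) instance of record `BSlot.small3 = (76·s₀, 19·s₁)`: THE y′-CORRIDOR's ARRIVAL READING ROW ALONG (`hLl` at `du.1 = 1`, axis 1) at the

builds on p205010 (kernel theorem, internal audit signed; external expert review pending) — nothing in this file uses p205010; NOTHING is claimed about any open node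
((N3-b), the end state).  Lane `prim-bschramm`, seat `prim-bschramm-p3` (gen 30; design owner; tool = captain gen-1 g4's port_genq.py R-14 --cone + p3-g30 slot-value patch T1).  Helper file (`--supports stmt-CriticalPhenomena-4575 --as helper`).
PORT RULES (U-wave r1–r4 re-used, GEN-Q hunk classes of p3-g29 #6136): declaration order, names and proof texts are those of «SkelFrmFromBChoiceArrivalYW», byte-identical except
(i) the carrier token `PlanarSkeletonFrmFrom ↦ PlanarSkeletonFrmQuasi` in binders, `namespace`/`end` lines and qualified names (module names `SkelFrmFrom… ↦ SkelFrmQuasi…`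
in imports of already-ported rows); (ii) `Φ.step ↦ Φ.qstep` with the called Steps lemma replaced by its `…Q`/`_q` twin and the cost `Φ.M` threaded (none in this file unless
listed below); (iii) `Φ.cyl_connected ↦ Φ.cyl_reach` readers (none unless listed); (iv) graph-ball radii / window floors ×`Φ.M` (none unless listed); (v) L-KitS-1 (design-owner ruling 2026-08-27): the (S0) kit data of «SkelFrmQuasiBChoiceNums» (stmt-g33, G017) are
N-parametrised — IN THIS FILE the readers `KS0.R'0/r₀0/r₀0_ge/base0/reach0 ↦ …N` resp. `KS.RA' ↦ KS.RAN'`, instantiated at `N := KS.NQ Φ = 13·max Φ.M 1`, nothing else.  Carrier-free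
residents stay imported/exported from the original «SkelFrmBChoiceArrivalYW» exactly as in the FrmFrom port.  Docstrings and citations are the original's.

-/

open scoped Classical

noncomputable section

namespace Summit.CriticalPhenomena.PercolationContinuityZ3.Theorems.Transplant

namespace PlanarSkeletonFrmQuasi

namespace NegB

open Literature.Probability.Percolation Literature.Probability.LatticeModels SimpleGraph
open SkelConc (Consts)
open Skelφ (shearUnit kgSL kgSLY kgXY kgFarY kgNY kgΔY rdLo rdHi KGYRows)
open TwoAxis.Para (modulus)
open Neg


-- GEN-Q T3 (p3-g30): residents/aliases of the row-less module(s) «SkelFrmFromBChoiceArrival», «SkelFrmFromBChoiceCreep» used below, re-exported here.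
export PlanarSkeletonFrm.NegB (two_mul_ediv_two rd1_div_eq)

/-! ## §1 The pure-integer core -/

export PlanarSkeletonFrm.NegB (arrivalY_coreW)

/-! ## §2 The centring at the tuple of record and the row -/

section ArrivalY

variable (κ : Consts) {V : Type} [DecidableEq V] [Countable V] {G : SimpleGraph V} [G.LocallyFinite] (Φ : PlanarSkeletonFrmQuasi G) (t : V) (p : unitInterval)
  (D : Skelφ.StepI.DataNS V) (g f mk : ℕ)

/- The tuple's atoms as hygiene-free local notations (they expand syntactically at each use; importers see the expanded terms). -/
set_option hygiene false in local notation "NYᵣ" => kgNYv0 κ Φ t p D g f mk (qxYQ4 κ Φ t p D g f) (WxYQ4 κ Φ t p D g f)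
set_option hygiene false in local notation "qYᵣ" => kgqY κ Φ t p D g f (qxYQ4 κ Φ t p D g f)
set_option hygiene false in local notation "WYᵣ" => kgWY κ Φ t p D g f (WxYQ4 κ Φ t p D g f)
set_option hygiene false in local notation "Rᵣ" => kgR κ Φ t p D mk
set_option hygiene false in local notation "nᵣ" => nL κ Φ t p D g f
set_option hygiene false in local notation "ℓᵣ" => ℓL κ Φ t p D g f
set_option hygiene false in local notation "hᵣ" => hL κ Φ t p D g f
set_option hygiene false in local notation "vᵣ" => vL κ Φ t p D g f
set_option hygiene false in local notation "Uᵣ" => shearUnit (nL κ Φ t p D g f) (hL κ Φ t p D g f)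
set_option hygiene false in local notation "Δᵣ" => modulus (nL κ Φ t p D g f) (hL κ Φ t p D g f) (vL κ Φ t p D g f) (vβL κ Φ t p D g f)
set_option hygiene false in local notation "sLᵣ" => kgSL (nL κ Φ t p D g f) (ℓL κ Φ t p D g f) (hL κ Φ t p D g f)
set_option hygiene false in local notation "s1ᵣ" => (((fcellsA κ Φ t p D g f).s 1 : ℕ) : ℤ)
set_option hygiene false in local notation "r1ᵣ" => (((fcellsA κ Φ t p D g f).r 1 : ℕ) : ℤ)
set_option hygiene false in local notation "Kᵣ" => ((Neg.K κ : ℕ) : ℤ)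
set_option hygiene false in local notation "LO1ᵣ" => rdLo (Aof κ) (nL κ Φ t p D g f) (hL κ Φ t p D g f) (vL κ Φ t p D g f) (vβL κ Φ t p D g f) (prFA κ Φ t p D g f).c₀ (prFA κ Φ t p D g f).c₁ (prFA κ Φ t p D g f).D (arrLoY3 κ Φ t p D g f mk) (arrHiY3 κ Φ t p D g f mk) 1
set_option hygiene false in local notation "HI1ᵣ" => rdHi (Aof κ) (nL κ Φ t p D g f) (hL κ Φ t p D g f) (vL κ Φ t p D g f) (vβL κ Φ t p D g f) (prFA κ Φ t p D g f).c₀ (prFA κ Φ t p D g f).c₁ (prFA κ Φ t p D g f).D (arrLoY3 κ Φ t p D g f mk) (arrHiY3 κ Φ t p D g f mk) 1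

/-- `U·pitchY ≤ 20K·Δ < U·pitchY + U` (`pitchY = ⌊20KΔ/U⌋`). [folklore] -/
theorem pitchY_floor_W (κ : Consts) {V : Type} [DecidableEq V] [Countable V] {G : SimpleGraph V} [G.LocallyFinite] (Φ : PlanarSkeletonFrmQuasi G) (t : V) (p : unitInterval) (D : Skelφ.StepI.DataNS V) (g : ℕ) (f : ℕ) (hN : EqNumL κ Φ t p D g f) :
    ((Uᵣ : ℕ) : ℤ) * pitchY κ Φ t p D g f ≤ 20 * Kᵣ * Δᵣ ∧ 20 * Kᵣ * Δᵣ < ((Uᵣ : ℕ) : ℤ) * pitchY κ Φ t p D g f + ((Uᵣ : ℕ) : ℤ) := by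
  obtain ⟨hn1, -⟩ := one_le_of_eqNumL κ Φ t p D g f hN
  have hU : (0 : ℤ) < (Uᵣ : ℕ) := Skelφ.shearUnit_pos hn1 _
  have epy : pitchY κ Φ t p D g f = 20 * Kᵣ * Δᵣ / (Uᵣ : ℕ) := rfl
  rw [epy]
  exact ⟨Int.mul_ediv_self_le (ne_of_gt hU), Int.lt_mul_ediv_self_add hU⟩

/-- `2·tgtY0 ∈ [2·pitchY + P₀ + sL + 3R′, 2·pitchY + P₀ + sL + 3R′ + 2]` (`P₀ = ⌊nℓ/U⌋`). [folklore] -/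
theorem tgtY0_two_mul_W (κ : Consts) {V : Type} [DecidableEq V] [Countable V] {G : SimpleGraph V} [G.LocallyFinite] (Φ : PlanarSkeletonFrmQuasi G) (t : V) (p : unitInterval) (D : Skelφ.StepI.DataNS V) (g : ℕ) (f : ℕ) (mk : ℕ) :
    2 * pitchY κ Φ t p D g f + ((nᵣ * ℓᵣ / Uᵣ : ℕ) : ℤ) + sLᵣ + 3 * ((Rᵣ : ℕ) : ℤ) ≤ 2 * kgTgtY0 κ Φ t p D g f mk ∧
      2 * kgTgtY0 κ Φ t p D g f mk ≤ 2 * pitchY κ Φ t p D g f + ((nᵣ * ℓᵣ / Uᵣ : ℕ) : ℤ) + sLᵣ + 3 * ((Rᵣ : ℕ) : ℤ) + 2 := by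
  have eT : kgTgtY0 κ Φ t p D g f mk = pitchY κ Φ t p D g f + ((((nᵣ * ℓᵣ / Uᵣ + 1 : ℕ) : ℤ) - 1) / 2) + (kgSLY nᵣ ℓᵣ hᵣ + kgΔY Rᵣ 0) / 2 := rfl
  have eΔ : kgΔY Rᵣ 0 = 3 * ((Rᵣ : ℕ) : ℤ) + 2 * ((0 : ℕ) : ℤ) + 2 := rfl
  have b1 := two_mul_ediv_two ((((nᵣ * ℓᵣ / Uᵣ + 1 : ℕ) : ℤ)) - 1)
  have b2 := two_mul_ediv_two (kgSLY nᵣ ℓᵣ hᵣ + kgΔY Rᵣ 0)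
  rw [eT]
  rw [eΔ, kgSLY_eq_kgSL] at b2 ⊢
  push_cast at b1 b2 ⊢
  constructor <;> linarith

/-- **ONE HOP FITS**: `FarY 0 = sL + XY 0 ≤ tgtY0` (`XY 0 ≤ 22·sL`, `pitchY ≥ 20K·sL − 1`). [this work] -/
theorem farY_zero_le_tgtY0_W (κ : Consts) {V : Type} [DecidableEq V] [Countable V] {G : SimpleGraph V} [G.LocallyFinite] (Φ : PlanarSkeletonFrmQuasi G) (t : V) (p : unitInterval) (D : Skelφ.StepI.DataNS V) (g : ℕ) (f : ℕ) (mk : ℕ) (hKq : 5 ≤ Neg.Kq κ) (hN : EqNumL κ Φ t p D g f) (hg : gFloorKG κ Φ t p D mk ≤ g) (hg2 : 40 * Neg.K κ * KS0.R'0N κ Φ (KS.NQ Φ) t p D mk ≤ g) :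
    kgFarY nᵣ ℓᵣ hᵣ vᵣ Rᵣ 0 qYᵣ WYᵣ 0 ≤ kgTgtY0 κ Φ t p D g f mk := by
  obtain ⟨hn1, -⟩ := one_le_of_eqNumL κ Φ t p D g f hN
  obtain ⟨-, -, hbig, hR1, hK40, -⟩ := valsQ_floor κ Φ t p D g f mk hN hg hg2
  have hUs := UsL_le_modulus κ Φ t p D g f hN
  obtain ⟨-, hpy2⟩ := pitchY_floor_W κ Φ t p D g f hN
  obtain ⟨ht1, -⟩ := tgtY0_two_mul_W κ Φ t p D g f mk
  have hK0 : (0 : ℤ) ≤ 20 * Kᵣ := by positivity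
  have hXY := (XY_le_3 κ Φ t p D g f mk hKq hN hg hg2 0 (by push_cast; linarith)).2
  have hU : (0 : ℤ) < (Uᵣ : ℕ) := Skelφ.shearUnit_pos hn1 _
  have hP0 : (0 : ℤ) ≤ ((nᵣ * ℓᵣ / Uᵣ : ℕ) : ℤ) := by positivity
  have hR0 : (0 : ℤ) ≤ ((KS0.R'0N κ Φ (KS.NQ Φ) t p D mk : ℕ) : ℤ) := by positivity
  have hRR : ((KS0.R'0N κ Φ (KS.NQ Φ) t p D mk : ℕ) : ℤ) = ((Rᵣ : ℕ) : ℤ) := rfl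
  rw [hRR] at hR0
  -- `pitchY ≥ 20K·sL − 1`
  have h20 : 20 * Kᵣ * (((Uᵣ : ℕ) : ℤ) * sLᵣ) ≤ 20 * Kᵣ * Δᵣ := mul_le_mul_of_nonneg_left hUs hK0
  have hpy : ((Uᵣ : ℕ) : ℤ) * (20 * Kᵣ * sLᵣ - 1) < ((Uᵣ : ℕ) : ℤ) * pitchY κ Φ t p D g f := by
    have e : ((Uᵣ : ℕ) : ℤ) * (20 * Kᵣ * sLᵣ - 1) = 20 * Kᵣ * (((Uᵣ : ℕ) : ℤ) * sLᵣ) - ((Uᵣ : ℕ) : ℤ) := by ring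
    linarith
  have hpy' := lt_of_mul_lt_mul_left hpy hU.le
  have hKs : 40 * sLᵣ ≤ Kᵣ * sLᵣ := mul_le_mul_of_nonneg_right hK40 (by linarith)
  unfold Skelφ.kgFarY
  rw [kgSLY_eq_kgSL]
  push_cast
  linarith

/-- **THE CENTRING AT THE TUPLE**: `FarY N ≤ tgtY0 < FarY N + sL + (3R′ + 2)` at `N := kgNYv0` (`kgNY_spec`). [this work] -/
theorem farY_spec_W (κ : Consts) {V : Type} [DecidableEq V] [Countable V] {G : SimpleGraph V} [G.LocallyFinite] (Φ : PlanarSkeletonFrmQuasi G) (t : V) (p : unitInterval) (D : Skelφ.StepI.DataNS V) (g : ℕ) (f : ℕ) (mk : ℕ) (hKq : 5 ≤ Neg.Kq κ) (hN : EqNumL κ Φ t p D g f) (hg : gFloorKG κ Φ t p D mk ≤ g) (hg2 : 40 * Neg.K κ * KS0.R'0N κ Φ (KS.NQ Φ) t p D mk ≤ g) :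
    (((NYᵣ : ℕ) : ℤ) + 1) * sLᵣ + kgXY nᵣ ℓᵣ hᵣ vᵣ Rᵣ 0 qYᵣ WYᵣ NYᵣ ≤ kgTgtY0 κ Φ t p D g f mk ∧ kgTgtY0 κ Φ t p D g f mk < (((NYᵣ : ℕ) : ℤ) + 1) * sLᵣ + kgXY nᵣ ℓᵣ hᵣ vᵣ Rᵣ 0 qYᵣ WYᵣ NYᵣ + sLᵣ + (3 * ((Rᵣ : ℕ) : ℤ) + 2) := by
  have H := kgYRows0_of κ Φ t p D g f mk (qxYQ4 κ Φ t p D g f) (WxYQ4 κ Φ t p D g f) hN hg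
  have hspec := H.kgNY_spec (farY_zero_le_tgtY0_W κ Φ t p D g f mk hKq hN hg hg2)
  have hNv : kgNY nᵣ ℓᵣ hᵣ vᵣ Rᵣ 0 qYᵣ WYᵣ (kgTgtY0 κ Φ t p D g f mk) = NYᵣ := rfl
  rw [hNv] at hspec
  have eΔ : kgΔY Rᵣ 0 = 3 * ((Rᵣ : ℕ) : ℤ) + 2 * ((0 : ℕ) : ℤ) + 2 := rfl
  unfold Skelφ.kgFarY at hspec
  rw [eΔ, kgSLY_eq_kgSL] at hspec
  push_cast at hspec
  exact ⟨by linarith [hspec.1], by linarith [hspec.2]⟩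

/-- **THE y′-ARRIVAL READING ROW, ALONG (`hLl` at `du.1 = 1`)**: `20r₁ − b₁ + 1 ≤ rdLo₁ ∧ 5r₁ ≤ rdLo₁ ∧ rdHi₁ ≤ 20r₁ + b₁ − 1 ∧ rdHi₁ ≤ 22r₁` for the box
`[arrLoY3, arrHiY3]` and the window of record `b₁ = BSlot.small3 1 = 19·s₁`. [this work] -/
theorem hLlY_W (κ : Consts) {V : Type} [DecidableEq V] [Countable V] {G : SimpleGraph V} [G.LocallyFinite] (Φ : PlanarSkeletonFrmQuasi G) (t : V) (p : unitInterval) (D : Skelφ.StepI.DataNS V) (g : ℕ) (f : ℕ) (mk : ℕ) (hKq : 5 ≤ Neg.Kq κ) (hN : EqNumL κ Φ t p D g f) (hg : gFloorKG κ Φ t p D mk ≤ g) (hg2 : 40 * Neg.K κ * KS0.R'0N κ Φ (KS.NQ Φ) t p D mk ≤ g) :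
    20 * r1ᵣ - ((BSlot.small3 κ Φ t p D g f 1 : ℕ) : ℤ) + 1 ≤ LO1ᵣ ∧ 5 * r1ᵣ ≤ LO1ᵣ ∧ HI1ᵣ ≤ 20 * r1ᵣ + ((BSlot.small3 κ Φ t p D g f 1 : ℕ) : ℤ) - 1 ∧ HI1ᵣ ≤ 22 * r1ᵣ := by
  obtain ⟨-, hsc1, hn1, -, hDp, hm, -, -, hkq, -⟩ := hsc_Q κ Φ t p D g f hN
  obtain ⟨-, hs40, hbig, hR1, hK40, -⟩ := valsQ_floor κ Φ t p D g f mk hN hg hg2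
  have hUs := UsL_le_modulus κ Φ t p D g f hN
  obtain ⟨hpy1, hpy2⟩ := pitchY_floor_W κ Φ t p D g f hN
  obtain ⟨ht1, ht2⟩ := tgtY0_two_mul_W κ Φ t p D g f mk
  obtain ⟨hfar, htgt⟩ := farY_spec_W κ Φ t p D g f mk hKq hN hg hg2
  have hP1 := Skelφ.natDiv_le_kgSLY hn1 ℓᵣ hᵣ
  rw [kgSLY_eq_kgSL] at hP1
  have hP0nat : ((nᵣ * ℓᵣ / Uᵣ : ℕ) : ℤ) = ((nᵣ : ℕ) : ℤ) * ℓᵣ / (Uᵣ : ℕ) := by push_cast; rfl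
  have hRR : ((KS0.R'0N κ Φ (KS.NQ Φ) t p D mk : ℕ) : ℤ) = ((Rᵣ : ℕ) : ℤ) := rfl
  rw [hRR] at hs40 hR1
  have hU : (0 : ℤ) < (Uᵣ : ℕ) := Skelφ.shearUnit_pos hn1 _
  have hU1 : (1 : ℤ) ≤ (Uᵣ : ℕ) := by linarith
  have hs1one : (1 : ℤ) ≤ s1ᵣ := by exact_mod_cast (fcellsA κ Φ t p D g f).hs 1
  -- the box rows
  obtain ⟨-, -, elo1, ehi1⟩ := arrY3_apply κ Φ t p D g f mk
  rw [kgSLY_eq_kgSL] at elo1 ehi1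
  have hlo : arrLoY3 κ Φ t p D g f mk 1 = arrHiY3 κ Φ t p D g f mk 1 - ((nᵣ * ℓᵣ / Uᵣ : ℕ) : ℤ) := by rw [elo1, ehi1, hP0nat]; push_cast; ring
  rw [← ehi1] at hfar htgt
  -- the fine-1 reading is `⌊s₁·X/Δ⌋`
  have hr1 : r1ᵣ = 40 * ((Neg.Kq κ : ℕ) : ℤ) * s1ᵣ := by
    rw [PCells2.r_eq, show ((fcellsA κ Φ t p D g f).K : ℤ) = Neg.K κ by exact_mod_cast (fcellsA_K κ Φ t p D g f).1,
      show (Neg.K κ : ℤ) = 40 * ((Neg.Kq κ : ℕ) : ℤ) by exact_mod_cast Neg.K_eq κ]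
  have hr1K : r1ᵣ = Kᵣ * s1ᵣ := by rw [PCells2.r_eq, show ((fcellsA κ Φ t p D g f).K : ℤ) = Neg.K κ by exact_mod_cast (fcellsA_K κ Φ t p D g f).1]
  have hb1 : ((BSlot.small3 κ Φ t p D g f 1 : ℕ) : ℤ) = 19 * s1ᵣ := by rw [(small3_eq κ Φ t p D g f).2]; push_cast; ring
  have hkq' : (0 : ℤ) < ((Neg.Kq κ : ℕ) : ℤ) := by exact_mod_cast hkq
  have hsc1' : (prFA κ Φ t p D g f).c₁ * Aof κ * (40 * ((Neg.Kq κ : ℕ) : ℤ) * Δᵣ) = 40 * ((Neg.Kq κ : ℕ) : ℤ) * s1ᵣ * (prFA κ Φ t p D g f).D := by rw [hsc1, hr1]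
  rw [Skelφ.rdLo_one, Skelφ.rdHi_one, rd1_div_eq (X := _) hDp hkq' hm hsc1', rd1_div_eq (X := _) hDp hkq' hm hsc1', hr1K, hb1]
  have hFlo' := Int.lt_mul_ediv_self_add (x := s1ᵣ * (((Uᵣ : ℕ) : ℤ) * arrLoY3 κ Φ t p D g f mk 1)) hm
  have hFhi := Int.mul_ediv_self_le (x := s1ᵣ * (((Uᵣ : ℕ) : ℤ) * arrHiY3 κ Φ t p D g f mk 1 + ((Uᵣ : ℕ) : ℤ) - 1)) (ne_of_gt hm)
  exact arrivalY_coreW (hU := hU1) (hUs := hUs) (hs := hbig) (hK := hK40) (hR := hR1) (hKR := hs40) (hP1 := hP1) (hpy1 := hpy1) (hpy2 := hpy2)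
    (ht1 := ht1) (ht2 := ht2) (hfar := hfar) (htgt := htgt) (hlo := hlo) (hs1 := hs1one) (hFlo' := hFlo') (hFhi := hFhi)

end ArrivalY

end NegB

end PlanarSkeletonFrmQuasi

end Summit.CriticalPhenomena.PercolationContinuityZ3.Theorems.Transplant

end
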